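import Literature.Topology.FourManifolds.SliceDiscExteriorMeridian
import Literature.Topology.FourManifolds.OpenTraceSimplyConnected
import Literature.Topology.FourManifolds.ZeroSurgeryHomotopyBallSliceConstruction
import Literature.Topology.FourManifolds.SliceDiscEndCollarFactsProofs
import Literature.Topology.FourManifolds.DehnSurgeryCompactProofs
import Literature.AlgebraicTopology.SingularHomology.HurewiczProofs
import HarnessLib

/-!
# Manolescu–Piccirillo's `X = X(K') ∪_Y V`, glued explicitly: `π₁(X) = 1` and `H₁` of the collar

Topic `Literature/Topology/FourManifolds`; fact item `provefact-Literature.Topology.FourManifolds.Knot.M-9195998579`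
for the named fact `Literature.Topology.FourManifolds.Knot.ManolescuPiccirillo2023_lemma33_sphere_core`
(`ZeroSurgeryHomotopyBallSliceProofs.lean`): Manolescu–Piccirillo (2023), proof of Lemma 3.3 for `W = S⁴` minus
Whitehead's theorem — knots `K, K'` with a common `0`-surgery `Y`, `K` smoothly slice ⇒ a closed smooth simply
connected `X` with `H₂(X; ℤ) = 0` in which `K'` bounds a smooth proper disc off a ball.

`ZeroSurgeryHomotopyBallSliceProofs.lean` reduced that fact to three named facts in *general complement form*
(`CONSTR`, `PI1`, `H2`: for every closed `X` carrying a ball, a proper disc and an open embedding of `B̊⁴ ∖ Δ`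
onto their complement). The two topological ones are much stronger than what the printed proof uses (they need
the `2`-handle structure around `e(𝔻⁴) ∪ f(𝔻²)` to be *recognised* inside an abstract `X`). This file and its
sequel `ZeroSurgeryHomotopyBallSliceCore.lean` instead follow the source literally: they glue the EXPLICIT open
trace of `K'` (`OpenTrace.lean`, `OpenTraceCollar.lean`: `T = TubeNbhd.OpenTrace ν'`, `0`-handle chart `inl`,
core disc `coreDisc`, collar `Y × ℝ ≅ T ∖ C`) to the open exterior `V = B̊⁴ ∖ Δ` of a conical slice disc of `K`
with its framed conical tube (`D : ConicalDiscTube K`, collar `Y × ℝ ≅ V ∖ K₀`, `SliceDiscEndCollar.lean`) along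
the two collars (`SmoothGlueData.ofCollars`, `ZeroSurgeryHomotopyBallSliceConstruction.lean`), and compute `π₁`
and `H₂` of the glued space from this structure. Here:

* `MPGlue.glueData` — the gluing datum `X = T ∪_{Y × ℝ} V`; `t2Space_glued`, `compactSpace_glued`,
  `secondCountableTopology_glued` (closed manifold), `isSliceDiscIn_glued` (`K'` bounds the core disc off the
  `0`-handle in `X`).
* **`MPGlue.simplyConnectedSpace_glued`: `π₁(X) = 1`.** `X = inl(T) ∪ inr(V)` with path connected overlap
  `≅ Y × ℝ`; loops in `inl(T)` die because the open trace is simply connected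
  (`TubeNbhd.simplyConnectedSpace_openTrace`, `OpenTraceSimplyConnected.lean`); loops in `inr(V)` die by
  Kervaire's lemma for the slice-disc exterior (`ConicalDiscTube.homotopic_refl_map_of_meridian`,
  `SliceDiscExteriorMeridian.lean`: `π₁(B̊⁴ ∖ Δ)` is normally generated by the meridian of `Δ`), since `inr`
  sends that meridian into the collar, i.e. into the simply connected `inl(T)`; Hatcher's Lemma 1.15
  (`Path.Homotopic.refl_of_isOpen_cover_two`) assembles. (MP: "`π₁(X) = π₁(V)/⟨[φ(μ_K')]⟩` … Since `π₁(V)` is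
  normally generated by `π₁(∂V)`, we have that `π₁(X) = 1`.")
* Tools for the `H₂` computation: Mayer–Vietoris criteria for Mathlib's singular homology from the proved
  exactness facts (`isZero_singularHomology_of_cover_of_mono`, `map_inter_right_surjective_of_isZero`),
  `H₁(S × (ℂ ∖ 0); ℤ) = ℤ · h(slice winding loop)` for simply connected `S`
  (`exists_eq_zsmul_loopClass_sliceWindingLoop`: Hurewicz onto + `π₁` generated by the winding loop), and the
  identification `homeomorphOfRangeEq` of an embedded model with a sub-subspace.
* **`MPGlue.exists_eq_zsmul_loopClass_handleMeridianE`: `H₁` of the collar `V ∖ K₀ ≅ Y × ℝ` is cyclic,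
  generated by the meridian `μ_P` of the core disc of the `2`-handle** (Mayer–Vietoris in the punctured open
  trace `T° = (open 2-handle) ∪ (T ∖ C)`, which is simply connected, `TubeNbhd.isSimplyConnected_compl_image_closedBall`,
  so `H₁(T°) = 0`); hence `h(μ_Δ) = n • h(μ_P)` in `H₁(V)` (`exists_loopClass_meridian_eq_zsmul`) and, the
  meridian `μ_Δ` of the slice disc having infinite order in `H₁(B̊⁴ ∖ Δ)`
  (`ConicalDiscTube.smul_loopClass_meridian_injective`), **`μ_P` has infinite order in `H₁(V; ℤ)`**
  (`smul_loopClass_handleMeridianV_injective`). This is the homological content of "`∂V ≅ S³₀(K)`,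
  `H₁(∂V) → H₁(V)` is injective" used by the source's "routine" homology computation, obtained here without
  identifying `Y`.

## References

* C. Manolescu, L. Piccirillo, *From zero surgeries to candidates for exotic definite 4-manifolds*,
  J. Lond. Math. Soc. (2) 108 (2023), §3.2, Lemma 3.3 and its proof, Def. 3.4 (arXiv:2102.04391: Lemma 3.5,
  Def. 3.6). [ManolescuPiccirillo2023]
* A. Hatcher, *Algebraic Topology*, CUP (2002), Lemma 1.15, Thm. 1.20, §2.2 pp. 149–150, Thm. 2A.1. [HatcherAT2002]

## Design notes

* Everything is stated for the data the final assembly has in hand: `ν : Knot.TubularNbhd K'` with a surgery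
  presentation `hG' : ν.toTubeNbhd.IsSurgeryWith jA' jB'` of `Y`, and `D : ConicalDiscTube K` with
  `hG : D.tube.IsSurgeryWith jA jB`; `Y : Type` (universe `0`, as in the fact).
* Homology is Mathlib's (`Literature.AlgebraicTopology.SingularHomology.singularHomology`), the model in which the
  Hurewicz class `loopClass`, Mayer–Vietoris (`mayerVietoris.exact₁/₂/₃_holds`) and excision are proved.
* No declaration in this file uses `sorry`; no named facts are introduced; no local notation.
-/


noncomputable section

open Set Metric Function Filter unitInterval OpenPartialHomeomorph
open scoped Topology Manifold ContDiff Real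

namespace Literature.Topology.FourManifolds


/-! ## Tools: Mayer–Vietoris criteria, cyclicity of `H₁` of a punctured-plane bundle, transport -/

section Tools

open CategoryTheory Limits Literature.AlgebraicTopology.SingularHomology
  Literature.AlgebraicTopology.FundamentalGroup.PuncturedPlane

universe u v

variable (R : Type v) [CommRing R] (M : Type v) [AddCommGroup M] [Module R M]

section MV

variable {A : Type u} [TopologicalSpace A] (U W : Set A)

/-- **Mayer–Vietoris, vanishing criterion** (Mathlib's singular homology; Hatcher (2002), §2.2 p. 149):
for a cover `A = U ∪ W` by sets with covering interiors, if `Hₙ₊₁(U) = Hₙ₊₁(W) = 0` and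
`Hₙ(U ∩ W) → Hₙ(U)` is injective then `Hₙ₊₁(A) = 0` — the connecting map `δ` is injective (its kernel is
the image of `0`) and `δ` followed by the injective component of `φ` is `0`. The trunk has this for
the concrete model (`isZero_csingularHomology_union_of_mono`); here from the proved Mathlib-model
exactness `mayerVietoris.exact₂_holds`, `δ_comp_φ`. [cite: HatcherAT2002, §2.2 p. 149] -/
theorem isZero_singularHomology_of_cover_of_mono (hcov : interior U ∪ interior W = univ) (n : ℕ)
    (hU : IsZero (singularHomology R M U (n + 1))) (hW : IsZero (singularHomology R M W (n + 1)))
    (hm : Mono (singularHomology.map R M (subsetInclusion (inter_subset_left : U ∩ W ⊆ U)) n)) :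
    IsZero (singularHomology R M A (n + 1)) := by
  have hexc := relativeSingularHomology.isIso_map_of_interior_union_interior_holds R M A
  have hψ : mayerVietoris.ψ R M U W (n + 1) = 0 := by
    refine biprod.hom_ext' _ _ ?_ ?_
    · rw [mayerVietoris.ψ, biprod.inl_desc, comp_zero]
      exact hU.eq_of_src _ _
    · rw [mayerVietoris.ψ, biprod.inr_desc, comp_zero]
      exact hW.eq_of_src _ _
  haveI : Mono (mayerVietoris.δ R M U W hexc hcov n) :=
    (mayerVietoris.exact₂_holds R M U W hexc hcov n).mono_g hψ
  have hδ0 : mayerVietoris.δ R M U W hexc hcov n = 0 := by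
    haveI := hm
    refine zero_of_comp_mono (singularHomology.map R M (subsetInclusion (inter_subset_left : U ∩ W ⊆ U)) n) ?_
    have h : mayerVietoris.φ R M U W n ≫ biprod.fst =
        singularHomology.map R M (subsetInclusion (inter_subset_left : U ∩ W ⊆ U)) n := by
      rw [mayerVietoris.φ, biprod.lift_fst]
    rw [← h, ← Category.assoc, mayerVietoris.δ_comp_φ, zero_comp]
  exact IsZero.of_mono_eq_zero _ hδ0

/-- **Mayer–Vietoris, surjectivity at `Hₙ(U) ⊕ Hₙ(W)`**: if `Hₙ(A) = 0` then `Hₙ(U ∩ W) → Hₙ(W)` is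
surjective (`mayerVietoris.exact₁_holds`; Hatcher (2002), §2.2 p. 149). [cite: HatcherAT2002, §2.2 p. 149] -/
theorem map_inter_right_surjective_of_isZero (hcov : interior U ∪ interior W = univ) (n : ℕ)
    (hA : IsZero (singularHomology R M A n)) :
    Function.Surjective (singularHomology.map R M (subsetInclusion (inter_subset_right : U ∩ W ⊆ W)) n) := by
  have hex := mayerVietoris.exact₁_holds R M U W hcov n
  have hψ : mayerVietoris.ψ R M U W n = 0 := hA.eq_of_tgt _ _
  haveI : Epi (mayerVietoris.φ R M U W n) := hex.epi_f hψ
  have hsurj := (ModuleCat.epi_iff_surjective (mayerVietoris.φ R M U W n)).1 inferInstance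
  intro y
  obtain ⟨x, hx⟩ := hsurj ((biprod.inr : _ ⟶ singularHomology R M U n ⊞ singularHomology R M W n) (-y))
  refine ⟨x, ?_⟩
  have h := congrArg (biprod.snd : singularHomology R M U n ⊞ singularHomology R M W n ⟶ _) hx
  rw [mayerVietoris.φ, biprod_snd_lift_apply, ← ModuleCat.comp_apply, biprod.inr_snd,
    ModuleCat.id_apply] at h
  exact neg_injective h

end MV

/-- The punctured plane `ℂ ∖ 0` is path connected. [folklore] -/
theorem pathConnectedSpace_cStar : PathConnectedSpace CStar := by
  have hrank : 1 < Module.rank ℝ ℂ := by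
    rw [← Module.finrank_eq_rank, Complex.finrank_real_complex]; norm_num
  exact isPathConnected_iff_pathConnectedSpace.1 (isPathConnected_compl_singleton_of_one_lt_rank hrank 0)

/-- **`H₁(S × (ℂ ∖ 0); ℤ)` is generated by the slice winding loop** for `S` simply connected: every
class is an integer multiple of its Hurewicz class (Hurewicz in degree one is onto,
`HurewiczProof.hurewiczOne_surjective`, and `π₁` is generated by the slice winding loop,
`PuncturedPlane.fromPath_mem_zpowers_slice`). [cite: HatcherAT2002, Thm. 2A.1] -/
theorem exists_eq_zsmul_loopClass_sliceWindingLoop {S : Type} [TopologicalSpace S] [SimplyConnectedSpace S]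
    (s₀ : S) (r : ℝ) (hr : 0 < r) (y : singularHomology ℤ ℤ (S × CStar) 1) :
    ∃ n : ℤ, y = n • loopClass ℤ ℤ (1 : ℤ) (sliceWindingLoop s₀ r hr) := by
  haveI := pathConnectedSpace_cStar
  obtain ⟨g, hg⟩ := HurewiczProof.hurewiczOne_surjective (s₀, bpt r hr) (Multiplicative.ofAdd y)
  obtain ⟨γ, hγ⟩ := Quotient.exists_rep (FundamentalGroup.toPath g)
  have hgγ : g = FundamentalGroup.fromPath (Path.Homotopic.Quotient.mk γ) := hγ.symm
  obtain ⟨n, hn⟩ := Subgroup.mem_zpowers_iff.1 (fromPath_mem_zpowers_slice s₀ r hr γ)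
  refine ⟨n, ?_⟩
  rw [hgγ, ← hn, map_zpow, hurewiczOne_fromPath] at hg
  apply Multiplicative.ofAdd.injective
  rw [← hg, ofAdd_zsmul]

section Transport

variable {Q X : Type*} [TopologicalSpace Q] [TopologicalSpace X] {S : Set X}

/-- **An embedding onto a sub-subset is a homeomorphism**: if `f : Q → X` is an embedding with
`range f = val '' P` for a subset `P` of the subspace `S`, then `Q ≃ₜ P`. [folklore] -/
def homeomorphOfRangeEq (P : Set ↥S) (f : Q → X) (hf : Topology.IsEmbedding f)
    (hP : range f = Subtype.val '' P) : Q ≃ₜ ↥P := by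
  have hS : ∀ q, f q ∈ S := fun q ↦ by
    obtain ⟨p, -, hp⟩ := (hP ▸ mem_range_self q : f q ∈ Subtype.val '' P)
    exact hp ▸ p.2
  have hPq : ∀ q, (⟨f q, hS q⟩ : ↥S) ∈ P := fun q ↦ by
    obtain ⟨p, hp, hpq⟩ := (hP ▸ mem_range_self q : f q ∈ Subtype.val '' P)
    have : p = ⟨f q, hS q⟩ := Subtype.ext hpq
    exact this ▸ hp
  have hr : ∀ p : ↥P, ((p : ↥S) : X) ∈ range f := fun p ↦ hP ▸ ⟨p, p.2, rfl⟩
  let e := hf.toHomeomorph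
  refine
    { toFun := fun q ↦ ⟨⟨f q, hS q⟩, hPq q⟩
      invFun := fun p ↦ e.symm ⟨_, hr p⟩
      left_inv := fun q ↦ ?_
      right_inv := fun p ↦ ?_
      continuous_toFun := (hf.continuous.subtype_mk _).subtype_mk _
      continuous_invFun := e.symm.continuous.comp
        ((continuous_subtype_val.comp continuous_subtype_val).subtype_mk _) }
  · change e.symm ⟨f q, _⟩ = q
    have h : (⟨f q, mem_range_self q⟩ : ↥(range f)) = e q := Subtype.ext rfl
    rw [h, e.symm_apply_apply]
  · apply Subtype.ext; apply Subtype.ext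
    change f (e.symm ⟨_, hr p⟩) = _
    have h := congrArg Subtype.val (e.apply_symm_apply ⟨_, hr p⟩)
    exact h

/-- Value of `homeomorphOfRangeEq`. [folklore] -/
@[simp] theorem coe_coe_homeomorphOfRangeEq (P : Set ↥S) (f : Q → X) (hf : Topology.IsEmbedding f)
    (hP : range f = Subtype.val '' P) (q : Q) :
    (((homeomorphOfRangeEq P f hf hP q : ↥P) : ↥S) : X) = f q := rfl

/-- Value of the inverse of `homeomorphOfRangeEq`. [folklore] -/
theorem apply_homeomorphOfRangeEq_symm (P : Set ↥S) (f : Q → X) (hf : Topology.IsEmbedding f)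
    (hP : range f = Subtype.val '' P) (p : ↥P) :
    f ((homeomorphOfRangeEq P f hf hP).symm p) = ((p : ↥S) : X) := by
  conv_rhs => rw [← (homeomorphOfRangeEq P f hf hP).apply_symm_apply p]
  rfl

end Transport

/-- Transport of "`y` is a multiple of the class of `ℓ`" along a continuous map. [folklore] -/
theorem map_zsmul_loopClass {P P' : Type u} [TopologicalSpace P] [TopologicalSpace P'] (g : C(P, P'))
    {p : P} (ℓ : Path p p) (n : ℤ) :
    singularHomology.map ℤ ℤ g 1 (n • loopClass ℤ ℤ (1 : ℤ) ℓ) = n • loopClass ℤ ℤ (1 : ℤ) (ℓ.map g.continuous) := by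
  rw [map_zsmul, map_loopClass]

end Tools


/-! ## The Manolescu–Piccirillo gluing datum -/

namespace MPGlue

variable {K K' : Knot} {Y : Type} [TopologicalSpace Y] [ChartedSpace (EuclideanSpace ℝ (Fin 3)) Y]
  (ν : Knot.TubularNbhd K') {jA' : ν.toTubeNbhd.complement → Y} {jB' : ↥solidTorus → Y}
  (hG' : ν.toTubeNbhd.IsSurgeryWith jA' jB')
  (D : ConicalDiscTube K) {jA : D.tube.complement → Y} {jB : ↥solidTorus → Y}
  (hG : D.tube.IsSurgeryWith jA jB)

/-- **the Manolescu–Piccirillo gluing datum** `X(K') ∪_Y V`: the open trace `T` of the `0`-framed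
tube `ν` of `K'` (`OpenTrace.lean`, with its collared end `Y × ℝ ≅ T ∖ C`, `OpenTraceCollar.lean`)
glued to the open exterior `V = B̊⁴ ∖ Δ` of a conical slice disc of `K` (with its collared end
`Y × ℝ ≅ V ∖ K₀`, `SliceDiscEndCollar.lean`) along the two collars of the common `0`-surgery `Y`
(`SmoothGlueData.ofCollars`). [cite: ManolescuPiccirillo2023, §3.2, proof of Lemma 3.3] -/
def glueData : SmoothGlueData (𝓡 4) (𝓡 4) ν.toTubeNbhd.shrink.OpenTrace ↥(sliceDiscExterior D.g)
    (EuclideanSpace ℝ (Fin 4)) :=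
  SmoothGlueData.ofCollars (ν.toTubeNbhd.collarPH hG') (D.collarPH hG) rfl (D.collarPH_source hG)
    (ν.toTubeNbhd.contMDiff_collar hG').contMDiffOn (ν.toTubeNbhd.contMDiffOn_collarInv hG')
    (D.contMDiffOn_collarPH hG) (D.contMDiffOn_collarPH_symm hG)
    (ContinuousLinearEquiv.refl ℝ _) (ContinuousLinearEquiv.refl ℝ _)

/-- The gluing region on the trace side is the collar `T ∖ C`. [folklore] -/
theorem glueData_glue_source : (glueData ν hG' D hG).glue.source = (ν.toTubeNbhd.coreC)ᶜ :=
  SmoothGlueData.ofCollars_glue_source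

/-- The gluing region on the exterior side is the collar `V ∖ K₀`. [folklore] -/
theorem glueData_glue_target : (glueData ν hG' D hG).glue.target = (D.collarPH hG).target :=
  SmoothGlueData.ofCollars_glue_target

/-- **The glued space is Hausdorff** (the two ends run off in opposite directions). [folklore] -/
theorem t2Space_glued : T2Space (glueData ν hG' D hG).Glued :=
  SmoothGlueData.t2Space_ofCollars (s := fun p : Y × ℝ ↦ p.2) continuous_snd
    (ν.toTubeNbhd.isClosed_image_collar_ge hG') (D.isClosed_image_collarPH_le hG)

/-- **The glued space is compact** (a closed `4`-manifold). [folklore] -/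
theorem compactSpace_glued : CompactSpace (glueData ν hG' D hG).Glued := by
  refine SmoothGlueData.compactSpace_ofCollars (fun p : Y × ℝ ↦ p.2) ?_ (D.isCompact_compl_target_union_image hG 0)
  have h : (ν.toTubeNbhd.collarPH hG').targetᶜ = ν.toTubeNbhd.coreC := compl_compl _
  rw [h]
  exact ν.toTubeNbhd.isCompact_coreC_union_image_le hG' 0

/-- The glued space is second countable. [folklore] -/
theorem secondCountableTopology_glued : SecondCountableTopology (glueData ν hG' D hG).Glued := by
  haveI := compactSpace_glued ν hG' D hG
  exact (glueData ν hG' D hG).secondCountableTopology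

/-- **`K'` bounds a smooth proper disc off a ball in the glued manifold**: the `0`-handle chart and the
core disc of the open trace, pushed into `X` by `inl`. [cite: ManolescuPiccirillo2023, §3.2, proof of Lemma 3.3] -/
theorem isSliceDiscIn_glued :
    K'.IsSliceDiscIn (glueData ν hG' D hG).Glued
      ((glueData ν hG' D hG).inl ∘ ν.toTubeNbhd.shrink.traceGlueData.inl)
      ((glueData ν hG' D hG).inl ∘ ν.toTubeNbhd.shrink.coreDisc) := by
  set d := glueData ν hG' D hG
  have himm : ∀ x, Injective (mfderiv (𝓡 4) (𝓡 4) d.inl x) := by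
    obtain ⟨F, _, _, hF⟩ := d.isSmoothEmbedding_inl.isImmersion
    exact fun x ↦ Manifold.IsImmersionAtOfComplement.mfderiv_injective (hF x) (by simp)
  have hef := TubeNbhd.isSliceDiscIn K' ν.toTubeNbhd.shrink
  exact hef.comp_of_injective d.inl_injective d.contMDiff_inl himm
    (d.isSmoothEmbedding_inl_comp hef.isSmoothEmbedding)

/-! ### The collar region and the meridians -/

/-- `‖(0 : ℝ²)‖ < 1`: the meridian used throughout is the one over the centre of the disc. [folklore] -/
theorem norm_zero_lt_one : ‖(0 : EuclideanSpace ℝ (Fin 2))‖ < 1 := by simp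

/-- **The meridian of the slice disc lies in the collar of the exterior** (its fibre radius `½` keeps it off
the compact core `K₀`). [folklore] -/
theorem meridian_mem_collarPH_target (θ : unitInterval) :
    D.meridian norm_zero_lt_one θ ∈ (D.collarPH hG).target := by
  rw [D.collarPH_target, mem_setOf_eq, D.coe_meridian]
  rintro ⟨-, hG'⟩
  exact hG' ⟨(0, Knot.TubularNbhd.fibreVec θ), ⟨by simp, Knot.TubularNbhd.fibreVec_mem_ball θ⟩, rfl⟩

/-- A point of the exterior collar, seen in `X`, lies in the image of the trace. [folklore] -/
theorem inr_mem_range_inl_of_mem_target {v : ↥(sliceDiscExterior D.g)} (hv : v ∈ (D.collarPH hG).target) :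
    (glueData ν hG' D hG).inr v ∈ range (glueData ν hG' D hG).inl := by
  rw [SmoothGlueData.inr_mem_range_inl_iff, glueData_glue_target]
  exact hv

/-- The overlap of the two pieces of `X` is the image of the exterior collar. [folklore] -/
theorem range_inl_inter_range_inr :
    range (glueData ν hG' D hG).inl ∩ range (glueData ν hG' D hG).inr =
      (glueData ν hG' D hG).inr '' (D.collarPH hG).target := by
  ext x
  constructor
  · rintro ⟨hl, ⟨v, rfl⟩⟩
    exact ⟨v, by rwa [SmoothGlueData.inr_mem_range_inl_iff, glueData_glue_target] at hl, rfl⟩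
  · rintro ⟨v, hv, rfl⟩
    exact ⟨inr_mem_range_inl_of_mem_target ν hG' D hG hv, v, rfl⟩

/-- The exterior collar is the image of `Y × ℝ`. [folklore] -/
theorem collarPH_target_eq_image : (D.collarPH hG).target = (D.collarPH hG) '' univ := by
  rw [← D.collarPH_source hG, OpenPartialHomeomorph.image_source_eq_target]

variable [PathConnectedSpace Y]

/-- The overlap of the two pieces of `X` is path connected (`≅ Y × ℝ`). [folklore] -/
theorem isPathConnected_range_inl_inter_range_inr :
    IsPathConnected (range (glueData ν hG' D hG).inl ∩ range (glueData ν hG' D hG).inr) := by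
  rw [range_inl_inter_range_inr, collarPH_target_eq_image]
  refine (isPathConnected_univ.image' ?_).image (glueData ν hG' D hG).continuous_inr
  rw [← D.collarPH_source hG]
  exact (D.collarPH hG).continuousOn

omit [PathConnectedSpace Y] in
/-- The image of the trace is simply connected. [folklore] -/
theorem isSimplyConnected_range_inl : IsSimplyConnected (range (glueData ν hG' D hG).inl) := by
  rw [← image_univ, (glueData ν hG' D hG).isOpenEmbedding_inl.isEmbedding.isSimplyConnected_image]
  haveI := ν.toTubeNbhd.shrink.simplyConnectedSpace_openTrace
  exact (Homeomorph.Set.univ ν.toTubeNbhd.shrink.OpenTrace).toHomotopyEquiv.simplyConnectedSpace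

/-- **`π₁(X) = 1` for the Manolescu–Piccirillo gluing** `X = X(K') ∪_Y V` (MP: "we have that
`π₁(X) = 1`"). Proof: `X` is covered by the open images of the trace `T` and of the exterior `V`, which
meet in the path connected collar `≅ Y × ℝ`; by Hatcher's Lemma 1.15
(`Path.Homotopic.refl_of_isOpen_cover_two`) it suffices that loops in either piece die in `X`. Loops
in the image of `T` die there, `T` being simply connected (`TubeNbhd.simplyConnectedSpace_openTrace`);
a loop in the image of `V` is `inr ∘ γ` for a loop `γ` of `V = B̊⁴ ∖ Δ`, and dies by Kervaire's lemma for
the slice-disc exterior (`ConicalDiscTube.homotopic_refl_map_of_meridian`): `inr` maps the meridian of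
the disc, which lies in the collar, into the simply connected image of `T`.
[cite: ManolescuPiccirillo2023, §3.2, proof of Lemma 3.3] [cite: HatcherAT2002, Lemma 1.15] -/
theorem simplyConnectedSpace_glued : SimplyConnectedSpace (glueData ν hG' D hG).Glued := by
  set d := glueData ν hG' D hG with hd
  -- the base point: the start of the meridian, in the overlap
  set v₀ : ↥(sliceDiscExterior D.g) := D.meridian norm_zero_lt_one 0 with hv₀
  have hv₀t : v₀ ∈ (D.collarPH hG).target := meridian_mem_collarPH_target D hG 0
  set x₀ : d.Glued := d.inr v₀ with hx₀
  have hxU : x₀ ∈ range d.inl := inr_mem_range_inl_of_mem_target ν hG' D hG hv₀t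
  have hxV : x₀ ∈ range d.inr := ⟨v₀, rfl⟩
  have hmeet := isPathConnected_range_inl_inter_range_inr ν hG' D hG
  -- `X` is path connected
  have hpc : IsPathConnected (univ : Set d.Glued) := by
    rw [← d.range_inl_union_range_inr]
    haveI := ν.toTubeNbhd.shrink.pathConnectedSpace_openTrace
    haveI := D.pathConnectedSpace_sliceDiscExterior
    exact (isPathConnected_range d.continuous_inl).union (isPathConnected_range d.continuous_inr)
      ⟨x₀, hxU, hxV⟩
  haveI : PathConnectedSpace d.Glued := pathConnectedSpace_iff_univ.2 hpc
  -- loops in the image of the trace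
  have hSC := isSimplyConnected_range_inl ν hG' D hG
  have hloopU : ∀ δ : Path x₀ x₀, (∀ s, δ s ∈ range d.inl) → δ.Homotopic (Path.refl x₀) :=
    fun δ hδ ↦ ConicalDiscTube.homotopic_refl_of_forall_mem hSC δ hδ
  -- loops in the image of the exterior: Kervaire's lemma
  have hloopV : ∀ δ : Path x₀ x₀, (∀ s, δ s ∈ range d.inr) → δ.Homotopic (Path.refl x₀) := by
    intro δ hδ
    let e := d.isOpenEmbedding_inr.isEmbedding.toHomeomorph
    have he : ∀ v, e v = ⟨d.inr v, v, rfl⟩ := fun v ↦ rfl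
    have hes : ∀ (x : d.Glued) (hx : x ∈ range d.inr), d.inr (e.symm ⟨x, hx⟩) = x := fun x hx ↦ by
      have h := congrArg Subtype.val (e.apply_symm_apply ⟨x, hx⟩)
      rwa [he] at h
    have hev : e.symm ⟨x₀, hxV⟩ = v₀ := by
      rw [← e.symm_apply_apply v₀, he]
    let δ' : Path v₀ v₀ :=
      { toFun := fun s ↦ e.symm ⟨δ s, hδ s⟩
        continuous_toFun := e.symm.continuous.comp (δ.continuous.subtype_mk _)
        source' := by simp only [Path.source]; exact hev
        target' := by simp only [Path.target]; exact hev }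
    let φ : C(↥(sliceDiscExterior D.g), d.Glued) := ⟨d.inr, d.continuous_inr⟩
    have hmer : ∀ t, φ (D.meridian norm_zero_lt_one t) ∈ range d.inl :=
      fun t ↦ inr_mem_range_inl_of_mem_target ν hG' D hG (meridian_mem_collarPH_target D hG t)
    have h := D.homotopic_refl_map_of_meridian φ hSC norm_zero_lt_one hmer δ'
    have e1 : δ'.map φ.continuous = δ := by
      ext s
      exact hes (δ s) (hδ s)
    rwa [e1] at h
  -- Hatcher's Lemma 1.15 and change of base point
  rw [simply_connected_iff_loops_nullhomotopic]
  refine ⟨inferInstance, fun x γ ↦ ?_⟩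
  have α : Path x₀ x := (hpc.joinedIn x₀ (mem_univ _) x (mem_univ _)).somePath
  exact Path.Homotopic.refl_of_conj α
    (Path.Homotopic.refl_of_isOpen_cover_two d.isOpen_range_inl d.isOpen_range_inr
      d.range_inl_union_range_inr hxU hxV hloopU hloopV hmeet _)

/-! ## `H₁` of the collar is cyclic, generated by the meridian of the core disc -/

section Collar

open CategoryTheory Limits Literature.AlgebraicTopology.SingularHomology
  Literature.AlgebraicTopology.FundamentalGroup.PuncturedPlane PlaneComplex

omit [PathConnectedSpace Y]

/-- **the model of the punctured `2`-handle**: `B̊² × (ℂ ∖ 0) → T`, `(x, ζ) ↦ inr (x, ζ)` (plane identified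
with `ℂ`); an embedding onto `inr(B̊² × (ℝ² ∖ 0))`, the overlap of the open `2`-handle `inr(B̊² × ℝ²)` with
the collar `T ∖ C` of the open trace [folklore] -/
def npMapT : C(↥(ball (0 : EuclideanSpace ℝ (Fin 2)) 1) × CStar, ν.toTubeNbhd.shrink.OpenTrace) where
  toFun q := ν.toTubeNbhd.shrink.traceGlueData.inr ((q.1 : EuclideanSpace ℝ (Fin 2)), ofC (q.2 : ℂ))
  continuous_toFun := ν.toTubeNbhd.shrink.traceGlueData.continuous_inr.comp
    ((continuous_subtype_val.comp continuous_fst).prodMk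
      (continuous_ofC.comp (continuous_subtype_val.comp continuous_snd)))

/-- Value of `npMapT`. [folklore] -/
theorem npMapT_apply (q : ↥(ball (0 : EuclideanSpace ℝ (Fin 2)) 1) × CStar) :
    npMapT ν q = ν.toTubeNbhd.shrink.traceGlueData.inr ((q.1 : EuclideanSpace ℝ (Fin 2)), ofC (q.2 : ℂ)) := rfl

/-- `ofC : ℂ → ℝ²` is an embedding (it is a homeomorphism with inverse `toC`). [folklore] -/
theorem isEmbedding_ofC : Topology.IsEmbedding ofC :=
  Topology.IsEmbedding.of_leftInverse (f := toC) toC_ofC continuous_toC continuous_ofC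

/-- The coordinate map `B̊² × (ℂ ∖ 0) → ℝ² × ℝ²`, `(x, ζ) ↦ (x, ofC ζ)`, is an embedding. [folklore] -/
theorem isEmbedding_npCoord :
    Topology.IsEmbedding (Prod.map (Subtype.val : ↥(ball (0 : EuclideanSpace ℝ (Fin 2)) 1) → EuclideanSpace ℝ (Fin 2))
      (ofC ∘ (Subtype.val : CStar → ℂ))) :=
  Topology.IsEmbedding.subtypeVal.prodMap (isEmbedding_ofC.comp Topology.IsEmbedding.subtypeVal)

/-- `npMapT` is an embedding. [folklore] -/
theorem isEmbedding_npMapT : Topology.IsEmbedding (npMapT ν) := by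
  have h : (npMapT ν : ↥(ball (0 : EuclideanSpace ℝ (Fin 2)) 1) × CStar → ν.toTubeNbhd.shrink.OpenTrace) =
      ν.toTubeNbhd.shrink.traceGlueData.inr ∘ Prod.map Subtype.val (ofC ∘ Subtype.val) := rfl
  rw [h]
  exact ν.toTubeNbhd.shrink.traceGlueData.isOpenEmbedding_inr.isEmbedding.comp isEmbedding_npCoord

/-- The range of `npMapT` is `inr(B̊² × (ℝ² ∖ 0))`. [folklore] -/
theorem range_npMapT :
    range (npMapT ν) = ν.toTubeNbhd.shrink.traceGlueData.inr ''
      (ball (0 : EuclideanSpace ℝ (Fin 2)) 1 ×ˢ ({0}ᶜ : Set (EuclideanSpace ℝ (Fin 2)))) := by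
  ext z
  constructor
  · rintro ⟨q, rfl⟩
    exact ⟨((q.1 : EuclideanSpace ℝ (Fin 2)), ofC (q.2 : ℂ)), ⟨q.1.2, ofC_ne_zero q.2.2⟩, rfl⟩
  · rintro ⟨⟨x, w⟩, ⟨hx, hw⟩, rfl⟩
    refine ⟨(⟨x, hx⟩, ⟨toC w, toC_ne_zero hw⟩), ?_⟩
    change ν.toTubeNbhd.shrink.traceGlueData.inr (x, ofC (toC w)) = _
    rw [ofC_toC]

/-- Points of the punctured handle are off the core `C`. [folklore] -/
theorem inr_not_mem_coreC {x w : EuclideanSpace ℝ (Fin 2)} (hx : ‖x‖ < 1) (hw : w ≠ 0) :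
    ν.toTubeNbhd.shrink.traceGlueData.inr (x, w) ∉ ν.toTubeNbhd.coreC := by
  rw [TubeNbhd.coreC, ν.toTubeNbhd.shrink.inr_mem_core_iff, not_or, not_le, not_and]
  exact ⟨hx, fun h ↦ absurd h hw⟩

/-- `npMapT` lands in the collar `T ∖ C` (the source of the gluing map). [folklore] -/
theorem npMapT_mem_glue_source (q : ↥(ball (0 : EuclideanSpace ℝ (Fin 2)) 1) × CStar) :
    npMapT ν q ∈ (glueData ν hG' D hG).glue.source := by
  rw [glueData_glue_source]
  exact inr_not_mem_coreC ν (mem_ball_zero_iff.1 q.1.2) (ofC_ne_zero q.2.2)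

/-- **the punctured `2`-handle pushed into the exterior collar**: `B̊² × (ℂ ∖ 0) → V ∖ K₀`, the model map
followed by the gluing map `c_V ∘ c_T⁻¹` [folklore] -/
def ιE : C(↥(ball (0 : EuclideanSpace ℝ (Fin 2)) 1) × CStar, ↥((D.collarPH hG).target)) where
  toFun q := ⟨(glueData ν hG' D hG).glue (npMapT ν q), by
    rw [← glueData_glue_target ν hG' D hG]
    exact (glueData ν hG' D hG).glue.map_source (npMapT_mem_glue_source ν hG' D hG q)⟩
  continuous_toFun := by
    refine Continuous.subtype_mk ?_ _
    exact (glueData ν hG' D hG).glue.continuousOn.comp_continuous (npMapT ν).continuous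
      (npMapT_mem_glue_source ν hG' D hG)

/-- Value of `ιE` in `V`. [folklore] -/
theorem coe_ιE (q : ↥(ball (0 : EuclideanSpace ℝ (Fin 2)) 1) × CStar) :
    (ιE ν hG' D hG q : ↥(sliceDiscExterior D.g)) = (glueData ν hG' D hG).glue (npMapT ν q) := rfl

/-- In `X`, `inr ∘ ιE = inl ∘ npMapT`. [folklore] -/
theorem inr_ιE (q : ↥(ball (0 : EuclideanSpace ℝ (Fin 2)) 1) × CStar) :
    (glueData ν hG' D hG).inr (ιE ν hG' D hG q : ↥(sliceDiscExterior D.g)) = (glueData ν hG' D hG).inl (npMapT ν q) :=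
  (glueData ν hG' D hG).inr_glue (npMapT_mem_glue_source ν hG' D hG q)

/-- `‖(0 : ℝ²)‖ < 1` as a point of the open disc. [folklore] -/
theorem zero_mem_ball_two : (0 : EuclideanSpace ℝ (Fin 2)) ∈ ball (0 : EuclideanSpace ℝ (Fin 2)) 1 := by simp

/-- **the meridian of the core disc of the `2`-handle**, `θ ↦ inr (0, ½ e^{2πiθ})`, pushed into the exterior
collar: the loop `ιE ∘` (slice winding loop of radius `½` over the centre) of `V ∖ K₀` [folklore] -/
def handleMeridianE : Path (ιE ν hG' D hG (⟨0, zero_mem_ball_two⟩, bpt (1 / 2) one_half_pos))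
    (ιE ν hG' D hG (⟨0, zero_mem_ball_two⟩, bpt (1 / 2) one_half_pos)) :=
  (sliceWindingLoop (⟨0, zero_mem_ball_two⟩ : ↥(ball (0 : EuclideanSpace ℝ (Fin 2)) 1)) (1 / 2) one_half_pos).map
    (ιE ν hG' D hG).continuous

/-- **the meridian of the core disc as a loop of the exterior `V`** [folklore] -/
def handleMeridianV : Path ((ιE ν hG' D hG (⟨0, zero_mem_ball_two⟩, bpt (1 / 2) one_half_pos) :
      ↥(sliceDiscExterior D.g))) (ιE ν hG' D hG (⟨0, zero_mem_ball_two⟩, bpt (1 / 2) one_half_pos)) :=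
  (handleMeridianE ν hG' D hG).map continuous_subtype_val

/-! ### The punctured open trace `T° = (2-handle) ∪ (collar)` and Mayer–Vietoris in degree one -/

/-- The open `2`-handle piece of `T°`, as a subset of the subspace `T°`. [folklore] -/
def npSet : Set ↥((ν.toTubeNbhd.shrink.traceGlueData.inl '' closedBall (0 : EuclideanSpace ℝ (Fin 4)) 1)ᶜ) :=
  Subtype.val ⁻¹' (ν.toTubeNbhd.shrink.traceGlueData.inr ''
    (ball (0 : EuclideanSpace ℝ (Fin 2)) 1 ×ˢ (univ : Set (EuclideanSpace ℝ (Fin 2)))))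

/-- The collar piece `T ∖ C` of `T°`, as a subset of the subspace `T°`. [folklore] -/
def eSet : Set ↥((ν.toTubeNbhd.shrink.traceGlueData.inl '' closedBall (0 : EuclideanSpace ℝ (Fin 4)) 1)ᶜ) :=
  Subtype.val ⁻¹' (ν.toTubeNbhd.coreC)ᶜ

/-- `npSet` is open. [folklore] -/
theorem isOpen_npSet : IsOpen (npSet ν) :=
  (ν.toTubeNbhd.shrink.traceGlueData.isOpenMap_inr _ (isOpen_ball.prod isOpen_univ)).preimage continuous_subtype_val

/-- `eSet` is open. [folklore] -/
theorem isOpen_eSet : IsOpen (eSet ν) :=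
  ν.toTubeNbhd.isClosed_coreC.isOpen_compl.preimage continuous_subtype_val

/-- **`T° = (2-handle) ∪ (collar)`**: a point of `T°` in the core `C` lies on the open core disc, inside the
open `2`-handle. [folklore] -/
theorem npSet_union_eSet : npSet ν ∪ eSet ν = univ := by
  refine eq_univ_of_forall fun z ↦ ?_
  by_cases hz : (z : ν.toTubeNbhd.shrink.OpenTrace) ∈ ν.toTubeNbhd.coreC
  · left
    have hz' := z.2
    rcases hz with h | ⟨x, hx, hxz⟩
    · exact absurd h hz'
    · rw [mem_closedBall, dist_zero_right] at hx
      rcases hx.lt_or_eq with hlt | heq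
      · refine ⟨(x, 0), ⟨by simpa using hlt, mem_univ _⟩, ?_⟩
        rw [← hxz, TubeNbhd.coreDisc_apply]
      · exfalso
        apply hz'
        have hx0 : x ≠ 0 := by rintro rfl; simp at heq
        rw [← hxz, ν.toTubeNbhd.shrink.coreDisc_eq_inl hx0, TubeNbhd.inl_mem_image_closedBall_iff,
          TubeNbhd.norm_traceBwd, heq, inv_one]
  · exact Or.inr hz

/-- The interiors of the two pieces cover `T°`. [folklore] -/
theorem interior_npSet_union_interior_eSet : interior (npSet ν) ∪ interior (eSet ν) = univ := by
  rw [(isOpen_npSet ν).interior_eq, (isOpen_eSet ν).interior_eq, npSet_union_eSet]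

/-- The overlap of the two pieces, seen in `T`, is the punctured handle `inr(B̊² × (ℝ² ∖ 0))`. [folklore] -/
theorem image_val_npSet_inter_eSet :
    Subtype.val '' (npSet ν ∩ eSet ν) = ν.toTubeNbhd.shrink.traceGlueData.inr ''
      (ball (0 : EuclideanSpace ℝ (Fin 2)) 1 ×ˢ ({0}ᶜ : Set (EuclideanSpace ℝ (Fin 2)))) := by
  ext z
  constructor
  · rintro ⟨z', ⟨⟨⟨x, w⟩, ⟨hx, -⟩, hxz⟩, he⟩, rfl⟩
    refine ⟨(x, w), ⟨hx, fun hw ↦ he ?_⟩, hxz⟩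
    have hw' : w = 0 := hw
    change (z' : ν.toTubeNbhd.shrink.OpenTrace) ∈ ν.toTubeNbhd.coreC
    rw [← hxz, hw', TubeNbhd.coreC, ν.toTubeNbhd.shrink.inr_mem_core_iff]
    have hx' : ‖x‖ < 1 := mem_ball_zero_iff.1 hx
    exact Or.inr ⟨rfl, hx'.le⟩
  · rintro ⟨⟨x, w⟩, ⟨hx, hw⟩, rfl⟩
    have hx' : ‖x‖ < 1 := mem_ball_zero_iff.1 hx
    have hTc : ν.toTubeNbhd.shrink.traceGlueData.inr (x, w) ∈
        (ν.toTubeNbhd.shrink.traceGlueData.inl '' closedBall (0 : EuclideanSpace ℝ (Fin 4)) 1)ᶜ := by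
      rw [mem_compl_iff, TubeNbhd.inr_mem_image_closedBall_iff, not_le]
      exact hx'
    exact ⟨⟨_, hTc⟩, ⟨⟨(x, w), ⟨hx, mem_univ _⟩, rfl⟩, inr_not_mem_coreC ν hx' hw⟩, rfl⟩

/-- The collar piece, seen in `T`, is the collar `T ∖ C`. [folklore] -/
theorem image_val_eSet : Subtype.val '' (eSet ν) = (ν.toTubeNbhd.coreC)ᶜ := by
  rw [eSet, Subtype.image_preimage_coe, inter_eq_right]
  intro z hz h
  exact hz (Or.inl h)

/-- **the model of the overlap**: `B̊² × (ℂ ∖ 0) ≅ npSet ∩ eSet` [folklore] -/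
def npHomeomorphT : ↥(ball (0 : EuclideanSpace ℝ (Fin 2)) 1) × CStar ≃ₜ ↥(npSet ν ∩ eSet ν) :=
  homeomorphOfRangeEq _ (npMapT ν) (isEmbedding_npMapT ν) ((range_npMapT ν).trans (image_val_npSet_inter_eSet ν).symm)

/-- The collar `T ∖ C` lies in `T°`. [folklore] -/
theorem compl_coreC_eq_inter :
    (ν.toTubeNbhd.coreC)ᶜ = (ν.toTubeNbhd.shrink.traceGlueData.inl '' closedBall (0 : EuclideanSpace ℝ (Fin 4)) 1)ᶜ ∩
      (ν.toTubeNbhd.coreC)ᶜ := by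
  rw [eq_comm, inter_eq_right]
  intro z hz h
  exact hz (Or.inl h)

/-- **the model of the collar piece**: the exterior collar `V ∖ K₀ ≅ eSet` through the gluing map
`c_T ∘ c_V⁻¹` (a composite of tautological identifications with the source–target homeomorphism of the
gluing partial homeomorphism) [folklore] -/
def eHomeomorphT : ↥((D.collarPH hG).target) ≃ₜ ↥(eSet ν) :=
  (Homeomorph.setCongr (glueData_glue_target ν hG' D hG).symm).trans
    ((glueData ν hG' D hG).glue.toHomeomorphSourceTarget.symm.trans
      ((Homeomorph.setCongr ((glueData_glue_source ν hG' D hG).trans (compl_coreC_eq_inter ν))).trans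
        (preimageValHomeomorph _ _).symm))

/-- Value of `eHomeomorphT` in `T`: the gluing map backwards. [folklore] -/
theorem coe_coe_eHomeomorphT (v : ↥((D.collarPH hG).target)) :
    (((eHomeomorphT ν hG' D hG v : ↥(eSet ν)) :
      ↥((ν.toTubeNbhd.shrink.traceGlueData.inl '' closedBall (0 : EuclideanSpace ℝ (Fin 4)) 1)ᶜ)) :
        ν.toTubeNbhd.shrink.OpenTrace) = (glueData ν hG' D hG).glue.symm (v : ↥(sliceDiscExterior D.g)) := rfl

/-- The overlap maps into the collar piece compatibly with the models: `incl ∘ npHomeomorphT = eHomeomorphT ∘ ιE`. [folklore] -/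
theorem inclusion_npHomeomorphT (q : ↥(ball (0 : EuclideanSpace ℝ (Fin 2)) 1) × CStar) :
    subsetInclusion (inter_subset_right : npSet ν ∩ eSet ν ⊆ eSet ν) (npHomeomorphT ν q) =
      eHomeomorphT ν hG' D hG (ιE ν hG' D hG q) := by
  apply Subtype.ext; apply Subtype.ext
  change npMapT ν q = (glueData ν hG' D hG).glue.symm ((glueData ν hG' D hG).glue (npMapT ν q))
  rw [(glueData ν hG' D hG).glue.left_inv (npMapT_mem_glue_source ν hG' D hG q)]

/-- `T°` is simply connected, as a space. [folklore] -/
theorem simplyConnectedSpace_puncturedTrace :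
    SimplyConnectedSpace ↥((ν.toTubeNbhd.shrink.traceGlueData.inl '' closedBall (0 : EuclideanSpace ℝ (Fin 4)) 1)ᶜ) :=
  ν.toTubeNbhd.shrink.isSimplyConnected_compl_image_closedBall

/-- **`H₁` of the exterior collar is cyclic, generated by the meridian of the core disc**: every class of
`H₁(V ∖ K₀; ℤ)` is a multiple of the Hurewicz class of `handleMeridianE`. Proof: transport to the collar
`T ∖ C ⊆ T° = (2-handle) ∪ (T ∖ C)` of the punctured open trace; `T°` is simply connected
(`TubeNbhd.isSimplyConnected_compl_image_closedBall`), so `H₁(T°) = 0`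
(`isZero_singularHomology_one_of_simplyConnectedSpace`) and Mayer–Vietoris makes
`H₁((2-handle) ∩ (T ∖ C)) → H₁(T ∖ C)` onto (`map_inter_right_surjective_of_isZero`); the overlap is
`B̊² × (ℝ² ∖ 0)`, whose `H₁` is generated by the meridian (`exists_eq_zsmul_loopClass_sliceWindingLoop`).
(MP: "thinking of gluing an upside down `X(−K')` onto a rightside up `V`".)
[cite: ManolescuPiccirillo2023, §3.2, proof of Lemma 3.3] [cite: HatcherAT2002, §2.2 p. 149] -/
theorem exists_eq_zsmul_loopClass_handleMeridianE (z : singularHomology ℤ ℤ ↥((D.collarPH hG).target) 1) :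
    ∃ n : ℤ, z = n • loopClass ℤ ℤ (1 : ℤ) (handleMeridianE ν hG' D hG) := by
  haveI := simplyConnectedSpace_puncturedTrace ν
  haveI : SimplyConnectedSpace ↥(ball (0 : EuclideanSpace ℝ (Fin 2)) 1) := by
    haveI := (convex_ball (0 : EuclideanSpace ℝ (Fin 2)) 1).contractibleSpace ⟨0, by simp⟩
    infer_instance
  set e₁ := npHomeomorphT ν with he₁
  set e₂ := eHomeomorphT ν hG' D hG with he₂
  let f₁ : C(↥(ball (0 : EuclideanSpace ℝ (Fin 2)) 1) × CStar, ↥(npSet ν ∩ eSet ν)) := e₁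
  let g₁ : C(↥(npSet ν ∩ eSet ν), ↥(ball (0 : EuclideanSpace ℝ (Fin 2)) 1) × CStar) := e₁.symm
  let f₂ : C(↥((D.collarPH hG).target), ↥(eSet ν)) := e₂
  -- transport `z` to the collar piece of `T°` and lift it to the overlap
  obtain ⟨y, hy⟩ := map_inter_right_surjective_of_isZero ℤ ℤ (npSet ν) (eSet ν)
    (interior_npSet_union_interior_eSet ν) 1 (isZero_singularHomology_one_of_simplyConnectedSpace ℤ ℤ)
    (singularHomology.map ℤ ℤ f₂ 1 z)
  -- the overlap is the model `B̊² × (ℂ ∖ 0)`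
  obtain ⟨n, hn⟩ := exists_eq_zsmul_loopClass_sliceWindingLoop
    (⟨0, zero_mem_ball_two⟩ : ↥(ball (0 : EuclideanSpace ℝ (Fin 2)) 1)) (1 / 2) one_half_pos
    (singularHomology.map ℤ ℤ g₁ 1 y)
  refine ⟨n, ?_⟩
  have hy' : y = singularHomology.map ℤ ℤ f₁ 1 (n • loopClass ℤ ℤ (1 : ℤ)
      (sliceWindingLoop (⟨0, zero_mem_ball_two⟩ : ↥(ball (0 : EuclideanSpace ℝ (Fin 2)) 1)) (1 / 2) one_half_pos)) := by
    rw [← hn, ← ModuleCat.comp_apply, ← singularHomology.map_comp]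
    have : f₁.comp g₁ = ContinuousMap.id _ := by
      ext p : 1; exact e₁.apply_symm_apply p
    rw [this, singularHomology.map_id, ModuleCat.id_apply]
  -- compare the inclusion with `ιE`
  have hcomp : (subsetInclusion (inter_subset_right : npSet ν ∩ eSet ν ⊆ eSet ν)).comp f₁ =
      f₂.comp (ιE ν hG' D hG) := by
    ext q : 1
    exact inclusion_npHomeomorphT ν hG' D hG q
  have key : singularHomology.map ℤ ℤ f₂ 1 z =
      singularHomology.map ℤ ℤ f₂ 1 (n • loopClass ℤ ℤ (1 : ℤ) (handleMeridianE ν hG' D hG)) := by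
    rw [← hy, hy', ← ModuleCat.comp_apply, ← singularHomology.map_comp, hcomp, singularHomology.map_comp,
      ModuleCat.comp_apply, map_zsmul_loopClass]
    rfl
  have hinj : Function.Injective (singularHomology.map ℤ ℤ f₂ 1) := by
    rw [← ModuleCat.mono_iff_injective]
    change Mono (singularHomology.mapIso ℤ ℤ e₂ 1).hom
    infer_instance
  exact hinj key

/-- **The Manolescu–Piccirillo meridian relation in `H₁(V)`**: the Hurewicz class of the meridian of the
slice disc `Δ` is a multiple of that of the meridian of the core disc of the `2`-handle (both loops lie in
the collar `V ∖ K₀ ≅ Y × ℝ`, whose `H₁` the latter generates). [cite: ManolescuPiccirillo2023, §3.2, proof of Lemma 3.3] -/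
theorem exists_loopClass_meridian_eq_zsmul :
    ∃ n : ℤ, loopClass ℤ ℤ (1 : ℤ) (D.meridian norm_zero_lt_one) = n • loopClass ℤ ℤ (1 : ℤ) (handleMeridianV ν hG' D hG) := by
  -- the meridian of the slice disc as a loop of the collar
  let mE : Path (⟨D.meridian norm_zero_lt_one 0, meridian_mem_collarPH_target D hG 0⟩ : ↥((D.collarPH hG).target))
      ⟨D.meridian norm_zero_lt_one 0, meridian_mem_collarPH_target D hG 0⟩ :=
    { toFun := fun t ↦ ⟨D.meridian norm_zero_lt_one t, meridian_mem_collarPH_target D hG t⟩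
      continuous_toFun := (D.meridian norm_zero_lt_one).continuous.subtype_mk _
      source' := rfl
      target' := Subtype.ext (by
        change D.meridian norm_zero_lt_one 1 = D.meridian norm_zero_lt_one 0
        rw [(D.meridian norm_zero_lt_one).source, (D.meridian norm_zero_lt_one).target]) }
  obtain ⟨n, hn⟩ := exists_eq_zsmul_loopClass_handleMeridianE ν hG' D hG (loopClass ℤ ℤ (1 : ℤ) mE)
  refine ⟨n, ?_⟩
  have h := congrArg (singularHomology.map ℤ ℤ (⟨Subtype.val, continuous_subtype_val⟩ :
    C(↥((D.collarPH hG).target), ↥(sliceDiscExterior D.g))) 1) hn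
  rw [map_loopClass, map_zsmul_loopClass] at h
  have e1 : loopClass ℤ ℤ (1 : ℤ) (mE.map continuous_subtype_val) = loopClass ℤ ℤ (1 : ℤ) (D.meridian norm_zero_lt_one) :=
    loopClass_eq_of_ofPath_eq ℤ ℤ 1 _ _ rfl
  rw [e1] at h
  exact h

/-- **The meridian of the core disc has infinite order in `H₁(V; ℤ)`**: `k ↦ k • h(μ_P)` is injective.
For the meridian `μ_Δ` of the slice disc has infinite order (`ConicalDiscTube.smul_loopClass_meridian_injective`,
Mayer–Vietoris in `B̊⁴`) and `h(μ_Δ) = n • h(μ_P)`. [cite: ManolescuPiccirillo2023, §3.2, proof of Lemma 3.3] -/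
theorem smul_loopClass_handleMeridianV_injective :
    Function.Injective fun k : ℤ ↦ k • loopClass ℤ ℤ (1 : ℤ) (handleMeridianV ν hG' D hG) := by
  obtain ⟨n, hn⟩ := exists_loopClass_meridian_eq_zsmul ν hG' D hG
  suffices key : ∀ k : ℤ, k • loopClass ℤ ℤ (1 : ℤ) (handleMeridianV ν hG' D hG) = 0 → k = 0 by
    intro k l hkl
    have := key (k - l) (by rw [sub_zsmul, add_neg_eq_zero]; exact hkl)
    omega
  intro k hk
  have h0 : k • loopClass ℤ ℤ (1 : ℤ) (D.meridian norm_zero_lt_one) = 0 := by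
    rw [hn, smul_smul, mul_comm, ← smul_smul, hk, zsmul_zero]
  exact D.smul_loopClass_meridian_injective norm_zero_lt_one (a₁ := k) (a₂ := 0) (by simpa using h0)

end Collar


end MPGlue

end Literature.Topology.FourManifolds
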